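/-
Copyright (c) 2026 the pub-hodgecm-mathlib formalisation cell (harness21).  Prover seat hodgecm-mathlib-LH4-p19 (g0), req620 Track A «(D-RAM) FOUR-FRAME» squad
(STAGE-1b, row (2) of the piece `f_{T₊}`, the (β₂) road (R-36) «PURE-CELL LEDGER»; β₂ sub-dealer LH4-p04 (g8) BETA2-BOARD v1.1 rows (L-D×)∕(L-K); LH4-p16 (g0) 16:15:33Z
«state `hlam` with the exponent as a parameter»), 2026-09-04.
-/
import Summits.HodgeConjecture.HodgeConjecture.Theorems.F0P3cDyRamDiagonalCellCleanRegime   -- ★ p861813 (this seat): `exists_eq_pow_mul_map_add`, `v_map_norm_sub_one_le`, `v_map_le_pow_iff`, `v_eq_pow_of_map_eq`, `refSkew_map_and_v`, `v_varpi_pow_le_pow`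
import HarnessLib

/-!
# Crux `H413`, line LH4 «(D-RAM) FOUR-FRAME» — STAGE-1b, row (2), the (β₂) road (R-36): «THE CLEAN REGIME AT PARAMETRIC PRECISION» — the clean letter
# `|lam − jE u₀₀ + jE(f·t₊·(ϖσϖ)^b)| ≤ |jEϖ|^{2b+N}` holds for some `σ`-fixed unit `f` as soon as `d` is even, `|u₀₀ − 1| ≤ |ϖ|^{N+1}` and `min(2b, δ) ≥ N + d − 1`
# (★ p861813 is the case `N = m*` up to one digit of `hum`; the cell `K₀ = (b+1, b)` of (L-K) takes `N = m* + 1` — LH4-p16 (g0) MECH-K0 (P3) «one δ-step later than D»)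

Cell `hodgecm-mathlib` (D-0151), FLOOR 0, crux item H413 = `stmt-HodgeConjecture-24833`, route of record `HCCMUnconditional`; squad F0∕P3c∕LH4; lane
`--supports stmt-HodgeConjecture-24833 --as helper` (count-neutral; pays NO tier-0 row).  THEOREMS ONLY (no `def`, no instance, no notation, no `sorry`, default heartbeats);
★-only imports; states NO law; (β₂) stays a HYPOTHESIS.  DATUM-FREE local algebra, letters of ★ p861813 VERBATIM with the level of record `m*` replaced by a parameter `N ≥ 1`.
* §1 `exists_fixed_unit_sub_mul_refSkew_le_of_le` — `d` even, `|t₀| = 1`, `|t₀ + σt₀| ≤ |ϖ|^{N+d−1}`, `1 ≤ N` ⟹ `∃ f` (`σ`-fixed unit), `|t₀ − f·t₊| ≤ |ϖ|^N`.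
* §2 `v_add_map_le_of_norm_near_one_of_le` — `u·σu = 1`, `|u − 1| ≤ |ϖ|^{N+1}`, `|μ_E| ≤ |ϖ|^{2b}`, `|N(u + μ_E) − 1| ≤ |ϖ|^{2b+δ}`, `N + d − 1 ≤ 2b, δ` ⟹ `|Tr μ_E| ≤ |ϖ|^{2b+N+d−1}`
  (one more digit of `hum` than ★ §2 buys the parity slack of the trace ideal).
* §3 `exists_fixed_unit_hlamE_of_le`, §4 HEAD `exists_fixed_unit_hlam_of_depths_of_le` — the E-side and the assembled M-side letters at precision `2b + N` (★ §4∕§5 reused by name).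
HONEST LABEL.  Count-neutral local algebra; nothing printed is asserted; no census law is stated; `HC_CM` is proved only modulo the 7 printed citations (2 remaining named inputs:
hLiu418 = `stmt-HodgeConjecture-24832`, h413 = `stmt-HodgeConjecture-24833`) until rung 0 closes.
## References
* [Serre1979] J.-P. Serre, *Local Fields*, GTM 67 (1979): Ch. I §6 Prop. 18, Ch. III §3 Prop. 7, Ch. III §6 Prop. 12, Ch. V §3 Cor. 3.
* [Jacobowitz1962] R. Jacobowitz, *Hermitian forms over local fields*, Amer. J. Math. 84 (1962): §4.
* [Rogawski1990] J. D. Rogawski, *Automorphic Representations of Unitary Groups in Three Variables*, Ann. of Math. Stud. 123 (1990): §4.9 Prop. 4.9.1 (b) p. 55, §12.2.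
-/

set_option autoImplicit false

noncomputable section

namespace Summit.HodgeConjecture.HodgeConjecture.Cruxes.H413.F0P3cDyRamConeCellCleanRegimeDeep

open scoped Valued WithZero
open WithZero
open Literature.NumberTheory.Automorphic.UnitaryThreeFourFrame (IsRamifiedQuadraticDatum)
open Literature.NumberTheory.LocalFields (exists_fixed_coords_of_map_ne v_fixed_add_fixed_mul_eq_max)
open Literature.NumberTheory.LocalFields.WildQuadraticDatum (v_add_map_le_exp v_varpi_pow even_log_v_of_fixed sub_map_ne_zero)
open Summit.HodgeConjecture.HodgeConjecture.Cruxes.H413.F0P3cDyRamDiagonalCellCleanRegime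

/-! ## §1 E-side, `d` even: a unit with deep trace is `≡ f·t₊ (mod 𝔭^N)` -/

section ESide

variable {K : Type} [Field K] [Valued K ℤᵐ⁰] {σ : K →+* K} {ϖ : K} {d t : ℕ}

/-- **§1 AT PRECISION `N`**: `d` even, `|t₀| = 1`, `|t₀ + σt₀| ≤ |ϖ|^{N+d−1}`, `1 ≤ N` ⟹ `∃ f`, `σ f = f`, `|f| = 1`, `|t₀ − f·t₊| ≤ |ϖ|^N` (Eisenstein coordinates of `t₀∕t₊`, ★
`exists_fixed_coords_of_map_ne`; `f := x₁`). [cite: Serre1979, Ch. I §6 Prop. 18] [cite: Serre1979, Ch. III §3 Prop. 7] -/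
theorem exists_fixed_unit_sub_mul_refSkew_le_of_le (hD : IsRamifiedQuadraticDatum σ ϖ d t) (hd2 : d % 2 = 0) {N : ℕ} (hN : 1 ≤ N)
    {t₀ : K} (ht₀ : Valued.v t₀ = 1) (htr : Valued.v (t₀ + σ t₀) ≤ Valued.v ϖ ^ (N + d - 1)) :
    ∃ f : K, σ f = f ∧ Valued.v f = 1 ∧
      Valued.v (t₀ - f * ((ϖ - σ ϖ) * ((ϖ * σ ϖ) ^ ((d - d % 2) / 2))⁻¹)) ≤ Valued.v ϖ ^ N := by
  obtain ⟨hσt, hvt⟩ := refSkew_map_and_v hD hd2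
  obtain ⟨hσσ, hvσ, hϖ, hfix, hdd, hd1, -⟩ := hD
  set tp : K := (ϖ - σ ϖ) * ((ϖ * σ ϖ) ^ ((d - d % 2) / 2))⁻¹ with htp
  have htp0 : tp ≠ 0 := fun h0 => by rw [h0, map_zero] at hvt; exact zero_ne_one hvt
  have hϖσ : σ ϖ ≠ ϖ := fun h => sub_map_ne_zero hϖ hdd (by rw [h, sub_self])
  have hfix' : ∀ c : K, σ c = c → c ≠ 0 → Even (log (Valued.v c)) := fun c hc hc0 => even_log_v_of_fixed hfix c hc hc0
  obtain ⟨x₁, y₁, hx₁, hy₁, hτ⟩ := exists_fixed_coords_of_map_ne hσσ hϖσ (t₀ / tp)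
  have hvτ : Valued.v (t₀ / tp) = 1 := by rw [map_div₀, ht₀, hvt, div_one]
  have hdiff : t₀ / tp - σ (t₀ / tp) = y₁ * (ϖ - σ ϖ) := by
    conv_lhs => rw [hτ, map_add, map_mul, hx₁, hy₁]
    ring
  have hdiff' : t₀ / tp - σ (t₀ / tp) = (t₀ + σ t₀) / tp := by
    rw [map_div₀, hσt]; field_simp; ring
  have hvy₁ : Valued.v y₁ ≤ Valued.v ϖ ^ (N - 1) := by
    have h1 : Valued.v (y₁ * (ϖ - σ ϖ)) ≤ Valued.v ϖ ^ (N + d - 1) := by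
      rw [← hdiff, hdiff', map_div₀, hvt, div_one]; exact htr
    rw [Valuation.map_mul, hdd] at h1
    have h0 : Valued.v ϖ ^ d ≠ 0 := pow_ne_zero _ (by rw [hϖ]; exact exp_ne_zero)
    have h2 : Valued.v ϖ ^ (N + d - 1) = Valued.v ϖ ^ (N - 1) * Valued.v ϖ ^ d := by rw [← pow_add]; congr 1; omega
    rw [h2] at h1
    exact le_of_mul_le_mul_right h1 (zero_lt_iff.2 h0)
  have hvx₁ : Valued.v x₁ = 1 := by
    have hmax := v_fixed_add_fixed_mul_eq_max hfix' hϖ hx₁ hy₁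
    rw [← hτ, hvτ] at hmax
    have hlt : Valued.v y₁ * exp (-1 : ℤ) < 1 := by
      have hy1 : Valued.v y₁ ≤ 1 := hvy₁.trans (pow_le_one' (by rw [hϖ, ← exp_zero, exp_le_exp]; norm_num) _)
      calc Valued.v y₁ * exp (-1 : ℤ) ≤ 1 * exp (-1 : ℤ) := by gcongr
        _ < 1 := by rw [one_mul, ← exp_zero, exp_lt_exp]; norm_num
    rcases le_total (Valued.v x₁) (Valued.v y₁ * exp (-1 : ℤ)) with h | h
    · rw [max_eq_right h] at hmax; exact absurd hmax.symm (ne_of_lt hlt)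
    · rw [max_eq_left h] at hmax; exact hmax.symm
  refine ⟨x₁, hx₁, hvx₁, ?_⟩
  have hrem : t₀ - x₁ * tp = y₁ * ϖ * tp := by
    have : t₀ = (t₀ / tp) * tp := by rw [div_mul_cancel₀ t₀ htp0]
    rw [this, hτ]; ring
  rw [hrem, Valuation.map_mul, Valuation.map_mul, hvt, mul_one]
  have hm : N = (N - 1) + 1 := by omega
  rw [hm, pow_add, pow_one]
  gcongr

/-! ## §2 E-side: the trace of the E-approximant at precision `2b + N + d − 1` -/

/-- **§2 AT PRECISION `N`**: `u·σu = 1`, `|u − 1| ≤ |ϖ|^{N+1}`, `|μ_E| ≤ |ϖ|^{2b}`, `|N(u + μ_E) − 1| ≤ |ϖ|^{2b+δ}`, `N + d − 1 ≤ 2b`, `N + d − 1 ≤ δ` ⟹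
`|μ_E + σμ_E| ≤ |ϖ|^{2b + (N + d − 1)}` (★ §2's proof; the extra digit of `hum` absorbs the parity of the trace ideal ★ `v_add_map_le_exp`).
[cite: Serre1979, Ch. III §3 Prop. 7] [cite: Serre1979, Ch. V §3 Cor. 3] -/
theorem v_add_map_le_of_norm_near_one_of_le (hD : IsRamifiedQuadraticDatum σ ϖ d t) {N : ℕ} {u μE : K} {b δ : ℕ}
    (huu : u * σ u = 1) (hu1 : Valued.v (u - 1) ≤ Valued.v ϖ ^ (N + 1)) (hμE : Valued.v μE ≤ Valued.v ϖ ^ (2 * b))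
    (hN : Valued.v ((u + μE) * σ (u + μE) - 1) ≤ Valued.v ϖ ^ (2 * b + δ))
    (hb : N + d - 1 ≤ 2 * b) (hδ : N + d - 1 ≤ δ) :
    Valued.v (μE + σ μE) ≤ Valued.v ϖ ^ (2 * b + (N + d - 1)) := by
  obtain ⟨hσσ, hvσ, hϖ, hfix, hdd, hd1, ht⟩ := hD
  set K₀ : ℕ := N + d - 1 with hK₀
  have hσu : σ u - 1 = σ (u - 1) := by rw [map_sub, map_one]
  have hsplit : μE + σ μE = (μE * σ u + σ (μE * σ u)) + (μE * (1 - σ u) + σ (μE * (1 - σ u))) := by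
    rw [map_mul, map_mul, hσσ, map_sub, map_one, hσσ]; ring
  have hA : μE * σ u + σ (μE * σ u) = ((u + μE) * σ (u + μE) - 1) - μE * σ μE := by
    rw [map_mul, hσσ, map_add]
    linear_combination -huu
  rw [hsplit]
  refine (Valuation.map_add _ _ _).trans (max_le ?_ ?_)
  · rw [hA]
    refine (Valuation.map_sub _ _ _).trans (max_le (hN.trans (v_varpi_pow_le_pow hϖ (by omega))) ?_)
    rw [Valuation.map_mul, hvσ]
    calc Valued.v μE * Valued.v μE ≤ Valued.v ϖ ^ (2 * b) * Valued.v ϖ ^ (2 * b) := by gcongr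
      _ = Valued.v ϖ ^ (2 * b + 2 * b) := by rw [pow_add]
      _ ≤ Valued.v ϖ ^ (2 * b + K₀) := v_varpi_pow_le_pow hϖ (by omega)
  · have hx : Valued.v (μE * (1 - σ u)) ≤ exp (-((2 * b + (N + 1) : ℕ) : ℤ)) := by
      have h1u : Valued.v (1 - σ u) ≤ Valued.v ϖ ^ (N + 1) := by
        rw [← Valuation.map_neg, neg_sub, hσu, hvσ]; exact hu1
      rw [← v_varpi_pow hϖ, Valuation.map_mul, pow_add]
      gcongr
    have h1 := v_add_map_le_exp hσσ hfix hϖ hdd ht (x := μE * (1 - σ u)) (j := ((2 * b + (N + 1) : ℕ) : ℤ))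
      (m := (((2 * b + K₀ + 1) / 2 : ℕ) : ℤ)) hx (by simp only [hK₀] at *; push_cast; omega)
    rw [v_varpi_pow hϖ]
    refine h1.trans (exp_le_exp.2 ?_)
    omega

/-! ## §3 E-side, `d` even: the clean letter on `E` at precision `2b + N` -/

/-- **§3 AT PRECISION `N`** (`d` even, `1 ≤ N`): `∃ f`, `σf = f`, `|f| = 1`, `|μ_E + f·t₊·(ϖσϖ)^b| ≤ |ϖ|^{2b + N}`. [cite: Serre1979, Ch. I §6 Prop. 18] [cite: Serre1979, Ch. III §3 Prop. 7] -/
theorem exists_fixed_unit_hlamE_of_le (hD : IsRamifiedQuadraticDatum σ ϖ d t) (hd2 : d % 2 = 0) {N : ℕ} (hN1 : 1 ≤ N) {u μE : K} {b δ : ℕ}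
    (huu : u * σ u = 1) (hu1 : Valued.v (u - 1) ≤ Valued.v ϖ ^ (N + 1)) (hμE : Valued.v μE = Valued.v ϖ ^ (2 * b))
    (hN : Valued.v ((u + μE) * σ (u + μE) - 1) ≤ Valued.v ϖ ^ (2 * b + δ))
    (hb : N + d - 1 ≤ 2 * b) (hδ : N + d - 1 ≤ δ) :
    ∃ f : K, σ f = f ∧ Valued.v f = 1 ∧
      Valued.v (μE + f * ((ϖ - σ ϖ) * ((ϖ * σ ϖ) ^ ((d - d % 2) / 2))⁻¹) * (ϖ * σ ϖ) ^ b) ≤ Valued.v ϖ ^ (2 * b + N) := by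
  have htrμ := v_add_map_le_of_norm_near_one_of_le hD huu hu1 (le_of_eq hμE) hN hb hδ
  have hσσ := hD.1
  have hvσ := hD.2.1
  have hϖ := hD.2.2.1
  have hvϖ0 : Valued.v ϖ ≠ 0 := by rw [hϖ]; exact exp_ne_zero
  have hϖ0 : ϖ ≠ 0 := fun h0 => by rw [h0, map_zero] at hvϖ0; exact hvϖ0 rfl
  have hP0 : (ϖ * σ ϖ) ^ b ≠ 0 := pow_ne_zero _ (mul_ne_zero hϖ0 ((map_ne_zero σ).2 hϖ0))
  have hvP : Valued.v ((ϖ * σ ϖ) ^ b) = Valued.v ϖ ^ (2 * b) := by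
    rw [Valuation.map_pow, Valuation.map_mul, hvσ, ← pow_two, ← pow_mul, mul_comm]
  have hσP : σ ((ϖ * σ ϖ) ^ b) = (ϖ * σ ϖ) ^ b := by rw [map_pow, map_mul, hσσ, mul_comm]
  set t₀ : K := -(μE / (ϖ * σ ϖ) ^ b) with ht₀def
  have ht₀ : Valued.v t₀ = 1 := by
    rw [ht₀def, Valuation.map_neg, map_div₀, hμE, hvP, div_self (pow_ne_zero _ hvϖ0)]
  have htr : Valued.v (t₀ + σ t₀) ≤ Valued.v ϖ ^ (N + d - 1) := by
    have h1 : t₀ + σ t₀ = -((μE + σ μE) / (ϖ * σ ϖ) ^ b) := by rw [ht₀def, map_neg, map_div₀, hσP]; ring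
    rw [h1, Valuation.map_neg, map_div₀, hvP]
    have h0 : (0 : ℤᵐ⁰) < Valued.v ϖ ^ (2 * b) := zero_lt_iff.2 (pow_ne_zero _ hvϖ0)
    rw [div_le_iff₀ h0, ← pow_add]
    refine htrμ.trans (v_varpi_pow_le_pow hϖ ?_)
    omega
  obtain ⟨f, hσf, hf1, hfle⟩ := exists_fixed_unit_sub_mul_refSkew_le_of_le hD hd2 hN1 ht₀ htr
  refine ⟨f, hσf, hf1, ?_⟩
  have hrew : μE + f * ((ϖ - σ ϖ) * ((ϖ * σ ϖ) ^ ((d - d % 2) / 2))⁻¹) * (ϖ * σ ϖ) ^ b =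
      -((ϖ * σ ϖ) ^ b) * (t₀ - f * ((ϖ - σ ϖ) * ((ϖ * σ ϖ) ^ ((d - d % 2) / 2))⁻¹)) := by
    rw [ht₀def]; field_simp; ring
  rw [hrew, Valuation.map_mul, Valuation.map_neg, hvP, pow_add]
  gcongr

end ESide

/-! ## §4 HEAD — the clean letter from the depths at precision `2b + N` -/

section MSide

variable {E M : Type} [Field E] [Valued E ℤᵐ⁰] [Field M] [Valued M ℤᵐ⁰] {ρ Θ : M →+* M} {α : M}

/-- **HEAD — «THE CLEAN REGIME AT PRECISION `N`»: `d` EVEN, `1 ≤ N`, `|u₀₀ − 1| ≤ |ϖ|^{N+1}`, `N + d − 1 ≤ 2b`, `N + d − 1 ≤ δ` ⟹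
`∃ f`, `σ f = f`, `|f| = 1`, `|lam − jE u₀₀ + jE(f·t₊·(ϖσϖ)^b)| ≤ |jEϖ|^{2b + N}`** — letters of ★ p861813 `exists_fixed_unit_hlam_of_depths` VERBATIM with `m*` ↦ `N` (★ §4
`exists_eq_pow_mul_map_add`, ★ §5 `v_map_norm_sub_one_le` by name).  D of (L-D×) takes `N = mstarOfRecord d`; K₀ of (L-K) takes `N = mstarOfRecord d + 1` (its `D₀` carries one more
`E`-digit, LH4-p16 (g0) 16:15:33Z). [cite: Serre1979, Ch. III §6 Prop. 12] [cite: Serre1979, Ch. III §3 Prop. 7] [cite: Jacobowitz1962, §4] [cite: Rogawski1990, §4.9 Prop. 4.9.1 (b) p. 55] -/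
theorem exists_fixed_unit_hlam_of_depths_of_le {σ : E →+* E} {ϖ : E} {d t : ℕ} (hD : IsRamifiedQuadraticDatum σ ϖ d t) (hd2 : d % 2 = 0) {N : ℕ} (hN1 : 1 ≤ N)
    (hρρ : ∀ x, ρ (ρ x) = x) (hα : ρ α ≠ α) (hα1 : Valued.v α ≤ 1) (hint : ∀ z : M, Valued.v z ≤ 1 → Valued.v ((z - ρ z) / (α - ρ α)) ≤ 1)
    (jE : E →+* M) (hjv : ∀ c, Valued.v (jE c) ≤ 1 ↔ Valued.v c ≤ 1) (hjfix : ∀ z, ρ z = z ↔ ∃ c, jE c = z)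
    (hΘj : ∀ c, Θ (jE c) = jE (σ c)) (hvΘ : ∀ x, Valued.v (Θ x) = Valued.v x)
    {lam : M} (hΘlam : Θ lam * lam = 1) (hlam1 : Valued.v lam = 1)
    {u : E} (huu : u * σ u = 1) (hu1 : Valued.v (u - 1) ≤ Valued.v ϖ ^ (N + 1))
    {b δ : ℕ} (hm : Valued.v (lam - jE u) = Valued.v (jE ϖ) ^ (2 * b))
    (hjl : Valued.v ((lam - jE u) - ρ (lam - jE u)) ≤ Valued.v (jE ϖ ^ (2 * b + δ) * (α - ρ α)))
    (hb : N + d - 1 ≤ 2 * b) (hδ : N + d - 1 ≤ δ) :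
    ∃ f : E, σ f = f ∧ Valued.v f = 1 ∧
      Valued.v (lam - jE u + jE (f * ((ϖ - σ ϖ) * ((ϖ * σ ϖ) ^ ((d - d % 2) / 2))⁻¹) * (ϖ * σ ϖ) ^ b)) ≤ Valued.v (jE ϖ) ^ (2 * b + N) := by
  have hϖ := hD.2.2.1
  have hvϖ0 : Valued.v ϖ ≠ 0 := by rw [hϖ]; exact exp_ne_zero
  have hϖ0 : ϖ ≠ 0 := fun h0 => by rw [h0, map_zero] at hvϖ0; exact hvϖ0 rfl
  have hπ0 : jE ϖ ≠ 0 := (map_ne_zero jE).2 hϖ0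
  have hπ1 : Valued.v (jE ϖ) ≤ 1 := (hjv ϖ).2 (by rw [hϖ, ← exp_zero, exp_le_exp]; norm_num)
  have hρπ : ρ (jE ϖ) = jE ϖ := (hjfix _).2 ⟨ϖ, rfl⟩
  have hd1 : 1 ≤ d := hD.2.2.2.2.2.1
  have hδ1 : 1 ≤ δ := le_trans (show 1 ≤ N + d - 1 by omega) hδ
  have hNδ : N ≤ δ := le_trans (show N ≤ N + d - 1 by omega) hδ
  set μ : M := lam - jE u with hμdef
  obtain ⟨e, y, he1, hy1, hμey⟩ := exists_eq_pow_mul_map_add hρρ hα hα1 hint jE hjfix hρπ hπ0 hπ1 hm.le hjl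
  set μE : E := ϖ ^ (2 * b) * e with hμEdef
  have hjμE : jE μE = jE ϖ ^ (2 * b) * jE e := by rw [hμEdef, map_mul, map_pow]
  have hθ : μ - jE μE = jE ϖ ^ (2 * b + δ) * y := by rw [hμey, hjμE]; ring
  have hvθ : Valued.v (μ - jE μE) ≤ Valued.v (jE ϖ) ^ (2 * b + δ) := by
    rw [hθ, Valuation.map_mul, Valuation.map_pow]
    calc Valued.v (jE ϖ) ^ (2 * b + δ) * Valued.v y ≤ Valued.v (jE ϖ) ^ (2 * b + δ) * 1 := by gcongr
      _ = _ := mul_one _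
  have hπlt : Valued.v (jE ϖ) < 1 := by
    refine lt_of_le_of_ne hπ1 fun h1 => ?_
    have h0 := v_eq_pow_of_map_eq jE hjv hϖ0 (c := ϖ) (n := 0) (by rw [pow_zero, h1])
    rw [pow_zero, hϖ, ← exp_zero] at h0
    exact absurd (exp_injective h0) (by norm_num)
  have hvμE : Valued.v μE = Valued.v ϖ ^ (2 * b) := by
    refine v_eq_pow_of_map_eq jE hjv hϖ0 ?_
    have hlt : Valued.v (-(μ - jE μE)) < Valued.v μ := by
      rw [Valuation.map_neg, hm]
      refine lt_of_le_of_lt hvθ ?_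
      exact pow_lt_pow_right_of_lt_one₀ (zero_lt_iff.2 ((Valuation.ne_zero_iff _).2 hπ0)) hπlt (Nat.lt_add_of_pos_right hδ1)
    have h2 : jE μE = μ + -(μ - jE μE) := by ring
    rw [h2, Valuation.map_add_eq_of_lt_left _ hlt, hm]
  have hxθ : Valued.v (lam - jE (u + μE)) ≤ Valued.v (jE ϖ) ^ (2 * b + δ) := by
    have : lam - jE (u + μE) = μ - jE μE := by rw [hμdef, map_add]; ring
    rw [this]; exact hvθ
  have hN' := v_map_norm_sub_one_le σ jE hΘj hvΘ hΘlam hlam1 (pow_le_one' hπ1 _) hxθ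
  have hNE : Valued.v ((u + μE) * σ (u + μE) - 1) ≤ Valued.v ϖ ^ (2 * b + δ) := by
    refine (v_map_le_pow_iff jE hjv hϖ0 _ _).1 ?_
    rw [map_sub, map_one]; exact hN'
  obtain ⟨f, hσf, hf1, hfE⟩ := exists_fixed_unit_hlamE_of_le hD hd2 hN1 huu hu1 hvμE hNE hb hδ
  refine ⟨f, hσf, hf1, ?_⟩
  have hfM : Valued.v (jE (μE + f * ((ϖ - σ ϖ) * ((ϖ * σ ϖ) ^ ((d - d % 2) / 2))⁻¹) * (ϖ * σ ϖ) ^ b)) ≤ Valued.v (jE ϖ) ^ (2 * b + N) :=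
    (v_map_le_pow_iff jE hjv hϖ0 _ _).2 hfE
  have hsplit : μ + jE (f * ((ϖ - σ ϖ) * ((ϖ * σ ϖ) ^ ((d - d % 2) / 2))⁻¹) * (ϖ * σ ϖ) ^ b) =
      (μ - jE μE) + jE (μE + f * ((ϖ - σ ϖ) * ((ϖ * σ ϖ) ^ ((d - d % 2) / 2))⁻¹) * (ϖ * σ ϖ) ^ b) := by rw [map_add]; ring
  rw [hsplit]
  refine (Valuation.map_add _ _ _).trans (max_le (hvθ.trans (pow_le_pow_right_of_le_one' hπ1 (Nat.add_le_add_left hNδ _))) hfM)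

end MSide

end Summit.HodgeConjecture.HodgeConjecture.Cruxes.H413.F0P3cDyRamConeCellCleanRegimeDeep

end
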